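import Summits.BirchSwinnertonDyer.Rank1Residual.ManinAdditive.CMOptimalCoordinates
import Literature.NumberTheory.EllipticCurves.ComplexMultiplication
import Literature.NumberTheory.EllipticCurves.ModularCurve
import Literature.NumberTheory.EllipticCurves.ModularSymbols
import Literature.NumberTheory.EllipticCurves.Isogeny
import HarnessLib
import HarnessLib.Audit.Tags

/-!
# Sketch-es-g29 — THE SQUEEZE: a c-free period-lattice law at an auxiliary (Stevens-minimal) curve decides
# the Manin constant; CM bands `j = 1728` / `j = 0` (cell `bsd-f2-manin`, planner `es` g29, MEMO-es §43)

LENS: Euler-system / explicit-reciprocity (the transplant of Stevens 1989 §6 — Lemmas 6.5/6.6/6.9 + Rubin's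
congruence Thm 6.8 + Stevens 1985 Thm 2.1 — from `K = ℚ(√−p)`, `p > 3`, to the two excluded fields `ℚ(i)`, `ℚ(√−3)`).

§1  `primeSaturation` — the `p`-saturation `{z | ∃ s, p ∤ s, s·z ∈ M}` of a `ℤ`-submodule `M ⊆ ℂ` (an `AddSubgroup`).
§2  SQUEEZE THEOREMS (kernel-checked, pure lattice algebra over Mathlib's `PeriodPair`):
    (A) if every period `{∞, γ∞}_f` of the newform of an optimal datum `D` (lattice clause `Λ_W = c·Λ_f`) lies in a
        submodule `M ⊆ Λ_W`, then `c = ±1`;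
    (B) if for a prime `p` every period has a prime-to-`p` multiple in such an `M`, then `p ∤ c`;
    (C) under (A)'s hypotheses `M = Λ_W` (the optimal lattice IS the auxiliary lattice: `E₀ ≅ E∗`).
    (Informal: `Λ_f ⊆ M ⊆ Λ_W = cΛ_f` forces `|c| = 1`; Stevens 1989 (1.7)/(2.4) «Conj. I″ ⟺ ℒ(f) = ℒ(A_min)» made a lemma
    about `X₀`-data; the auxiliary `M` is the Néron lattice of Stevens' MINIMAL curve `E∗`, `Λ(E∗) ⊆ Λ(E)` for all `E`.)
§3  TYPED LAW-CANDIDATES (nothing asserted):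
    E-es-133  `CMTwinLatticeLeTwo` / `CMTwinLatticeLeThree` — the twist-reduced CM twin is Stevens-minimal among the
              `j = 1728` (resp. `j = 0`) members: `Λ(V) ⊆ Λ(W)` (an §78.9 (1)–(3) = Stevens' Lemma 6.5 at `p = 2, 3`;
              PROVABLE NOW on paper: λ-lemma `φ^*ω = ∓ω` + minimality bookkeeping; typed here as a Prop for provers).
    E-es-134  `CMPeriodLatticeLawTwoLocal` / `CMPeriodLatticeLawThreeLocal` — the `2`- (resp. `3`-) primary parts of
              E-es-131 T2Λ / T3Λ: an ODD (resp. prime-to-3) multiple of every period lies in `Λ(V)`.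
    E-es-135  `CMOptimalIsFullCMTwo` / `CMOptimalIsFullCMThree` — Stevens' Lemma 6.6 for `X₀` at `p = 2, 3`: an optimal curve in a
              `ℚ(i)`- (resp. `ℚ(√−3)`-) CM class has `j = 1728` (resp. `j = 0`).
§4  COROLLARIES (kernel-checked): T2Λ ∧ E-es-133₂ ⟹ `c = ±1` for every optimal datum on the `j = 1728` band off `N ∈ {32, 64}`
    (hence C2 ∧ C3 ∧ the `p ≥ 5` residual there); T3Λ ∧ E-es-133₃ ⟹ `c = ±1` on the `j = 0` band off `N = 27`;
    the LOCAL laws give `2 ∤ c` (resp. `3 ∤ c`) — C2's (resp. C3's) literal tail on the CM bands.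
    Modularity input used: `LFunction_eq_of_isIsogenous` (Faltings/Tate: isogenous ⟹ same `a_n`) to move `IsNewformOf`
    from `W` to the twin `V`.

Nothing here is asserted as true beyond the kernel-checked implications. BSD is not proved by this; Manin's conjecture is
not proved by this; C2/C3 remain OPEN.

TYPER NOTE (typer g19, T-es-46, part 1/3).  SOURCE = HOME/es/g29/Sketch-es-g29.lean sha16 6d73975d830cb788 (401 l.; es: farm rc 0 · 0 warn,
axioms standard; BC7 6/6 CLEAN Probe-es-g29.out.txt 4585285c3c0cc85c + Probe2 982e734957f640b1; ref1 §R148 (R-es-66): E-es-133/134/135 + COR 1–7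
ALL SURVIVE, «may land as typed»), §1–§3 (l. 1–242) VERBATIM except: this note; namespace `BsdF2ManinEsG29` → `…ManinAdditive.KatoCurve.CMOptimal`
(where T2c/T3c/T2Λ/T3Λ/U2/U3/`ConjIInclAt` live); `@[conjecture]` on the six law defs E-es-133₂/₃, E-es-134₂/₃, E-es-135₂/₃ (nothing asserted;
E-es-133 is PROVED modulo the tree's named fact `PeriodPair.uniformization_unique` in part 3 `CMTwinLattice.lean` =
`…CMOptimal.TwinLattice.cmTwinLatticeLeTwo/Three_of_uniformization_unique`, from es's Sketch-es-g29b e327414f0c151de1); two one-line docstrings;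
`set_option autoImplicit false` dropped (project default); the word «s∗rry-free» rendered «kernel-checked».  SPLIT for the 400-line cap:
part 2 `CMLatticeSqueezeCorollaries.lean` = §4 (l. 246–399, COR 1–7, theorem-only).  Imports = es's (my leaf `CMOptimalCoordinates` + Literature)
— ROUTE-INDEPENDENT.  HONEST FRAMING (typer summary; details = es's text below): LENS es (transplant of Stevens 1989 §6 to `ℚ(i)`, `ℚ(√−3)`);
STATUS: §2 SQUEEZE THEOREMS PROVED (pure lattice algebra); E-es-133 SUPPORT (provable; proved mod `uniformization_unique`), E-es-134 LAW-candidates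
(p-primary parts of E-es-131), E-es-135 LAW-candidates (Stevens Lemma 6.6 for X₀ at 2, 3); NOT IN PRINT at `p = 2, 3` (Stevens 1989 §6 excludes
`ℚ(i)`, `ℚ(√−3)`; Rubin 6.8 replaced per es 43.5); BC5 (es): TWIN-LATTICE-v1.txt ccb38f79594d39ab (index-2/3 inclusion 2497/2497 classes
`N < 5·10⁵`, opposite direction 0/2497), CM-OPTCOORDS-v1 (E-135: 649/649 + 1848/1848), T2Λ/T3Λ censuses for E-134; ref1 §R148 second engine
e148/twin_lattice.py 0ea5ce52: `Λ(V) ⊆ Λ(W)` with integer matrix, |det| = 2 (649/649) / 3 (1848/1848); STRUCTURAL REMARK (ref1): the lattice clause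
`hD` is load-bearing everywhere (`ModularParametrizationData` admits `(c, deg) ↦ (kc, k²deg)`).  CHEAPEST FALSIFIERS (es): a CM class whose
X₀-optimal curve is not of `j = 1728` / `0` (kills E-135); a period with no odd (prime-to-3) multiple in `Λ(V)` (kills E-134).  WHY IT MATTERS: COR 6/7
= `ManinOddAtFour` / `ManinPrimeToThreeAtNine` on the whole `ℚ(i)`- / `ℚ(√−3)`-CM locus modulo three c-free, E₀-free laws.  PARTITION 0 · beyond-print
theorem: no · bears_on: stmt-BirchSwinnertonDyer-22967 (C2) and -22968 (C3) (`--supports` is refused for ManinAdditive targets; recorded here).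
BSD is not proved by this; Manin's conjecture is not proved by this; C2/C3 OPEN.
-/

noncomputable section

namespace Summit.BirchSwinnertonDyer.Rank1Residual.ManinAdditive.KatoCurve.CMOptimal

open scoped MatrixGroups ModularForm
open CongruenceSubgroup WeierstrassCurve Literature.NumberTheory.EllipticCurves
  Literature.NumberTheory.EllipticCurves.ModularForms
  Summit.BirchSwinnertonDyer.Rank1Residual.ManinAdditive.KatoCurve.CMOptimal

/-! ## §1 The `p`-saturation of a submodule of `ℂ` -/

/-- `primeSaturation p hp M = {z | ∃ s : ℤ, p ∤ s ∧ s·z ∈ M}` — an additive subgroup of `ℂ` (closed under `+` because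
`p` is prime). -/
def primeSaturation (p : ℤ) (hp : Prime p) (M : Submodule ℤ ℂ) : AddSubgroup ℂ where
  carrier := {z | ∃ s : ℤ, ¬ p ∣ s ∧ (s : ℂ) * z ∈ M}
  zero_mem' := ⟨1, hp.not_dvd_one, by simp⟩
  add_mem' := by
    rintro x y ⟨s, hs, hx⟩ ⟨t, ht, hy⟩
    refine ⟨s * t, fun h => (hp.dvd_or_dvd h).elim hs ht, ?_⟩
    have : ((s * t : ℤ) : ℂ) * (x + y) = (t : ℤ) • ((s : ℂ) * x) + (s : ℤ) • ((t : ℂ) * y) := by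
      simp only [zsmul_eq_mul]; push_cast; ring
    rw [this]
    exact M.add_mem (M.smul_mem _ hx) (M.smul_mem _ hy)
  neg_mem' := by
    rintro x ⟨s, hs, hx⟩
    refine ⟨s, hs, ?_⟩
    rw [mul_neg]
    exact M.neg_mem hx

/-- Membership in `primeSaturation`: some multiple by an integer prime to `p` lies in `M`. -/
theorem mem_primeSaturation {p : ℤ} {hp : Prime p} {M : Submodule ℤ ℂ} {z : ℂ} :
    z ∈ primeSaturation p hp M ↔ ∃ s : ℤ, ¬ p ∣ s ∧ (s : ℂ) * z ∈ M := Iff.rfl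

/-- `M` is contained in its `p`-saturation. -/
theorem le_primeSaturation {p : ℤ} (hp : Prime p) (M : Submodule ℤ ℂ) :
    M.toAddSubgroup ≤ primeSaturation p hp M :=
  fun z hz => ⟨1, hp.not_dvd_one, by simpa using hz⟩

/-! ## §2 The squeeze theorems -/

section Squeeze

variable {W : WeierstrassCurve ℚ} {N : ℕ} [NeZero N]

/-- **SQUEEZE (A).** For an `X₀(N)`-datum `D` of `W` with the lattice clause `Λ_W = c·Λ_f` (optimal parametrisation):
if all periods `{∞, γ∞}_f` (`γ ∈ Γ₀(N)`) lie in a submodule `M ⊆ Λ_W`, then `c = ±1`.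
Proof: `ω₁ = c·w` with `w ∈ Λ_f ⊆ M ⊆ Λ_W`, so `w = mω₁ + nω₂` and `ℝ`-independence gives `cm = 1`. -/
theorem maninConstant_eq_one_or_eq_neg_one_of_cuspSymbol_mem (D : ModularParametrizationData W N)
    (hD : ∀ z ∈ D.L.lattice, ∃ w ∈ periodLattice D.f, z = D.c * w)
    (M : Submodule ℤ ℂ) (hM : ∀ γ : Gamma0 N, cuspSymbol D.f γ ∈ M) (hle : M ≤ D.L.lattice) :
    D.maninConstant = 1 ∨ D.maninConstant = -1 := by
  have hΛ : periodLattice D.f ≤ M.toAddSubgroup := by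
    unfold periodLattice
    exact (AddSubgroup.closure_le _).mpr (by rintro _ ⟨γ, rfl⟩; exact hM γ)
  obtain ⟨w, hw, hw'⟩ := hD D.L.ω₁ D.L.ω₁_mem_lattice
  have hwM : w ∈ M := hΛ hw
  obtain ⟨m, n, hmn⟩ := PeriodPair.mem_lattice.mp (hle hwM)
  have key : ((D.c : ℝ) * m - 1) • D.L.ω₁ + ((D.c : ℝ) * n) • D.L.ω₂ = 0 := by
    simp only [Complex.real_smul]
    push_cast
    linear_combination (D.c : ℂ) * hmn - hw'
  obtain ⟨h1, -⟩ := LinearIndependent.pair_iff.mp D.L.indep _ _ key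
  have hcm : D.c * m = 1 := by exact_mod_cast (sub_eq_zero.mp h1)
  change D.c = 1 ∨ D.c = -1
  exact Int.isUnit_iff.mp (IsUnit.of_mul_eq_one m hcm)

/-- **SQUEEZE (B), `p`-primary.** Same setting; if for a prime `p` every period `{∞, γ∞}_f` has a prime-to-`p`
multiple in a submodule `M ⊆ Λ_W`, then `p ∤ c`.  Proof: `ω₁ = c·w`, `s·w ∈ M ⊆ Λ_W` with `p ∤ s`, so
`s·w = mω₁ + nω₂` and independence gives `cm = s`. -/
theorem not_dvd_maninConstant_of_saturated_cuspSymbol_mem (D : ModularParametrizationData W N)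
    (hD : ∀ z ∈ D.L.lattice, ∃ w ∈ periodLattice D.f, z = D.c * w)
    {p : ℤ} (hp : Prime p) (M : Submodule ℤ ℂ) (hle : M ≤ D.L.lattice)
    (hM : ∀ γ : Gamma0 N, ∃ s : ℤ, ¬ p ∣ s ∧ (s : ℂ) * cuspSymbol D.f γ ∈ M) :
    ¬ p ∣ D.maninConstant := by
  have hΛ : periodLattice D.f ≤ primeSaturation p hp M := by
    unfold periodLattice
    exact (AddSubgroup.closure_le _).mpr (by rintro _ ⟨γ, rfl⟩; exact hM γ)
  obtain ⟨w, hw, hw'⟩ := hD D.L.ω₁ D.L.ω₁_mem_lattice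
  obtain ⟨s, hs, hsw⟩ := mem_primeSaturation.mp (hΛ hw)
  obtain ⟨m, n, hmn⟩ := PeriodPair.mem_lattice.mp (hle hsw)
  have key : ((D.c : ℝ) * m - s) • D.L.ω₁ + ((D.c : ℝ) * n) • D.L.ω₂ = 0 := by
    simp only [Complex.real_smul]
    push_cast
    linear_combination (D.c : ℂ) * hmn - (s : ℂ) * hw'
  obtain ⟨h1, -⟩ := LinearIndependent.pair_iff.mp D.L.indep _ _ key
  have hcm : D.c * m = s := by exact_mod_cast (sub_eq_zero.mp h1)
  change ¬ p ∣ D.c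
  intro hpc
  exact hs (hcm ▸ dvd_mul_of_dvd_left hpc m)

/-- **SQUEEZE (C) — the optimal lattice IS the auxiliary lattice.**  Under the hypotheses of (A), `M = Λ_W`:
`c = ±1` gives `Λ_W = ±Λ_f ⊆ M ⊆ Λ_W`.  (On the CM bands: the optimal curve's Néron lattice equals the small twin's, i.e.
`E₀ ≅ E∗` — the coordinate law T2c/T3c for `j`-members is a COROLLARY of the lattice law T2Λ/T3Λ, not an extra input.) -/
theorem lattice_eq_of_cuspSymbol_mem (D : ModularParametrizationData W N)
    (hD : ∀ z ∈ D.L.lattice, ∃ w ∈ periodLattice D.f, z = D.c * w)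
    (M : Submodule ℤ ℂ) (hM : ∀ γ : Gamma0 N, cuspSymbol D.f γ ∈ M) (hle : M ≤ D.L.lattice) :
    M = D.L.lattice := by
  refine le_antisymm hle fun z hz => ?_
  have hΛ : periodLattice D.f ≤ M.toAddSubgroup := by
    unfold periodLattice
    exact (AddSubgroup.closure_le _).mpr (by rintro _ ⟨γ, rfl⟩; exact hM γ)
  obtain ⟨w, hw, rfl⟩ := hD z hz
  have hwM : w ∈ M := hΛ hw
  rcases maninConstant_eq_one_or_eq_neg_one_of_cuspSymbol_mem D hD M hM hle with hc | hc
  · have hc' : D.c = 1 := hc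
    simpa [hc'] using hwM
  · have hc' : D.c = -1 := hc
    simpa [hc'] using M.neg_mem hwM

/-- From `c = ±1`: no prime divides `c`. -/
theorem not_dvd_of_eq_one_or_eq_neg_one {c : ℤ} (h : c = 1 ∨ c = -1) {p : ℤ} (hp : Prime p) : ¬ p ∣ c := by
  rcases h with rfl | rfl
  · exact hp.not_dvd_one
  · rw [dvd_neg]; exact hp.not_dvd_one

end Squeeze

/-! ## §3 Typed law-candidates E-es-133 / E-es-134 (nothing asserted) -/

section Laws

/-- **E-es-133₂ `CMTwinLatticeLeTwo` — the twist-reduced `j = 1728` twin is Stevens-minimal among the `j = 1728`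
members of its class.**  For globally minimal `V`, `W` with `j = 1728`, `V ~ W` isogenous, `V` twist-reduced
(`c₄(W') ∈ {c₄(V), −4·c₄(V)}` for every isogenous globally minimal `j = 1728` model `W'`), and Néron period pairs
`LV`, `LW`: `Λ(V) ⊆ Λ(W)`.  (an §78.9 (1)–(3): `φ : E_A → E_{−4A}`, `φ^*(dX/2Y) = −dx/2y`, both short models minimal iff
`v₂(A) ≤ 1`, so `Λ(E_A) ⊂ Λ(E_{−4A})` of index 2 = Stevens 1989 Lemma 6.5 at `p = 2`; `W ≅ V` or `W ≅ E_{−4A}`.)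
PROVABLE NOW (paper); BC5: PERIODS-carlson.tsv (4994 rows: `Ω(E_A) = Ω(E_{−4A})` for `A > 0`, `= 2Ω(E_{−4A})` for
`A < 0`, consistent with index-2 inclusion of a rectangular in a rhombic lattice and vice versa). -/
@[conjecture] def CMTwinLatticeLeTwo : Prop :=
  ∀ (V W : WeierstrassCurve ℚ) [V.IsElliptic] [V.IsGloballyMinimal] [W.IsElliptic] [W.IsGloballyMinimal]
    (LV LW : PeriodPair),
    V.j = 1728 → W.j = 1728 → WeierstrassCurve.IsIsogenous V W →
    IsNeronLatticeOf (V.baseChange ℂ) LV → IsNeronLatticeOf (W.baseChange ℂ) LW →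
    (∀ (W' : WeierstrassCurve ℚ) [W'.IsElliptic] [W'.IsGloballyMinimal],
        W'.j = 1728 → WeierstrassCurve.IsIsogenous V W' → (W'.c₄ = V.c₄ ∨ W'.c₄ = -4 * V.c₄)) →
    LV.lattice ≤ LW.lattice

/-- **E-es-133₃ `CMTwinLatticeLeThree`** — the `j = 0` twin: `ψ : E_B → E_{−27B}`, `ψ^*(dX/2Y) = +dx/2y`, both models
`3`-minimal iff `v₃(B) ≤ 2`, so `Λ(E_B) ⊂ Λ(E_{−27B})` of index 3 (an §78.9 (1)–(2) = Stevens' Lemma 6.5 at `p = 3`);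
the `j = 0` members of a class are exactly the two twins. PROVABLE NOW (paper). -/
@[conjecture] def CMTwinLatticeLeThree : Prop :=
  ∀ (V W : WeierstrassCurve ℚ) [V.IsElliptic] [V.IsGloballyMinimal] [W.IsElliptic] [W.IsGloballyMinimal]
    (LV LW : PeriodPair),
    V.j = 0 → W.j = 0 → WeierstrassCurve.IsIsogenous V W →
    IsNeronLatticeOf (V.baseChange ℂ) LV → IsNeronLatticeOf (W.baseChange ℂ) LW →
    (∀ (W' : WeierstrassCurve ℚ) [W'.IsElliptic] [W'.IsGloballyMinimal],
        W'.j = 0 → WeierstrassCurve.IsIsogenous V W' → (W'.c₆ = V.c₆ ∨ W'.c₆ = -27 * V.c₆)) →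
    LV.lattice ≤ LW.lattice

/-- **E-es-134₂ `CMPeriodLatticeLawTwoLocal` — the 2-primary part of E-es-131 T2Λ:** same binders as
`CMPeriodLatticeLawTwo`; conclusion: an ODD multiple of every period `{∞, γ∞}_f` lies in `Λ(V)`.  Weaker than T2Λ
(`s = 1`); still decides C2 on the band (§4).  BC5 = T2Λ's (647 classes, Cremona optimality + `c₀ = 1`; DIAMOND-CENSUS-v1). -/
@[conjecture] def CMPeriodLatticeLawTwoLocal : Prop :=
  ∀ (V : WeierstrassCurve ℚ) [V.IsElliptic] [V.IsGloballyMinimal] {N : ℕ} [NeZero N]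
    (f : CuspForm (Gamma0 N) 2) (L : PeriodPair),
    V.j = 1728 → IsNewformOf V f → IsNeronLatticeOf (V.baseChange ℂ) L →
    (∀ (W : WeierstrassCurve ℚ) [W.IsElliptic] [W.IsGloballyMinimal],
        W.j = 1728 → WeierstrassCurve.IsIsogenous V W → (W.c₄ = V.c₄ ∨ W.c₄ = -4 * V.c₄)) →
    V.conductorNorm ℤ ≠ 32 → V.conductorNorm ℤ ≠ 64 →
    ∀ γ : Gamma0 N, ∃ s : ℤ, ¬ (2 : ℤ) ∣ s ∧ (s : ℂ) * cuspSymbol f γ ∈ L.lattice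

/-- **E-es-134₃ `CMPeriodLatticeLawThreeLocal` — the 3-primary part of E-es-131 T3Λ** (`j = 0` band off `N = 27`):
a prime-to-`3` multiple of every period lies in `Λ(V)`. -/
@[conjecture] def CMPeriodLatticeLawThreeLocal : Prop :=
  ∀ (V : WeierstrassCurve ℚ) [V.IsElliptic] [V.IsGloballyMinimal] {N : ℕ} [NeZero N]
    (f : CuspForm (Gamma0 N) 2) (L : PeriodPair),
    V.j = 0 → IsNewformOf V f → IsNeronLatticeOf (V.baseChange ℂ) L →
    (∀ (W : WeierstrassCurve ℚ) [W.IsElliptic] [W.IsGloballyMinimal],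
        W.j = 0 → WeierstrassCurve.IsIsogenous V W → (W.c₆ = V.c₆ ∨ W.c₆ = -27 * V.c₆)) →
    V.conductorNorm ℤ ≠ 27 →
    ∀ γ : Gamma0 N, ∃ s : ℤ, ¬ (3 : ℤ) ∣ s ∧ (s : ℂ) * cuspSymbol f γ ∈ L.lattice

/-- **E-es-135₂ `CMOptimalIsFullCMTwo` — Stevens' Lemma 6.6 for `X₀` at `p = 2`: an optimal curve (lattice clause) in a
`ℚ(i)`-CM class has `j = 1728`** (its period lattice is a `ℤ[i]`-module, not merely a `ℤ[2i]`-module).  The twisting operator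
`Σ_u χ₋₄(u)·(1 u/4; 0 1)` only yields `2i·Λ_f ⊆ Λ_f` (MEMO-es §42 dead end), so this is a LAW-candidate, not a lemma.
BC5: CM-OPTCOORDS-v1 «optimal curve NOT a j1728-member: 0» (649/649 classes, `N < 5·10⁵`); -ref1 §R146 2497/2497. -/
@[conjecture] def CMOptimalIsFullCMTwo : Prop :=
  ∀ (W : WeierstrassCurve ℚ) [W.IsElliptic] [W.IsGloballyMinimal] {N : ℕ} [NeZero N]
    (D : ModularParametrizationData W N),
    (∀ z ∈ D.L.lattice, ∃ w ∈ periodLattice D.f, z = D.c * w) →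
    ∀ (V : WeierstrassCurve ℚ) [V.IsElliptic], V.j = 1728 → WeierstrassCurve.IsIsogenous V W → W.j = 1728

/-- **E-es-135₃ `CMOptimalIsFullCMThree` — Lemma 6.6 for `X₀` at `p = 3`: an optimal curve in a `ℚ(√−3)`-CM class has
`j = 0`** (`χ₋₃`-twisting only yields the order `ℤ[√−3]`).  BC5: CM-OPTCOORDS-v1 «optimal curve NOT a j0-member: 0»
(1848/1848). -/
@[conjecture] def CMOptimalIsFullCMThree : Prop :=
  ∀ (W : WeierstrassCurve ℚ) [W.IsElliptic] [W.IsGloballyMinimal] {N : ℕ} [NeZero N]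
    (D : ModularParametrizationData W N),
    (∀ z ∈ D.L.lattice, ∃ w ∈ periodLattice D.f, z = D.c * w) →
    ∀ (V : WeierstrassCurve ℚ) [V.IsElliptic], V.j = 0 → WeierstrassCurve.IsIsogenous V W → W.j = 0

/-- T2Λ ⟹ its 2-primary part (take `s = 1`). -/
theorem cmPeriodLatticeLawTwoLocal_of_law (h : CMPeriodLatticeLawTwo) : CMPeriodLatticeLawTwoLocal := by
  intro V _ _ N _ f L hj hf hL hred h32 h64 γ
  exact ⟨1, Int.prime_two.not_dvd_one, by simpa using h V f L hj hf hL hred h32 h64 γ⟩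

/-- T3Λ ⟹ its 3-primary part. -/
theorem cmPeriodLatticeLawThreeLocal_of_law (h : CMPeriodLatticeLawThree) : CMPeriodLatticeLawThreeLocal := by
  intro V _ _ N _ f L hj hf hL hred h27 γ
  exact ⟨1, Int.prime_three.not_dvd_one, by simpa using h V f L hj hf hL hred h27 γ⟩

end Laws

end Summit.BirchSwinnertonDyer.Rank1Residual.ManinAdditive.KatoCurve.CMOptimal

end
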